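import Literature.AlgebraicGeometry.ModuliOfAbelianVarieties.SiegelAdelicMarkingLevelReading
import Literature.AlgebraicGeometry.AbelianSchemes.AbelianSchemeSymplecticLevel
import HarnessLib

/-!
# A symplectic lift BUILT from a marking: the torsion tower of `A` read through `[J, a]`
# ([Lan 2013] Lemma 1.3.6.5; [Deligne 1971] 4.12 (b); [Milne 2005] Thm. 6.11, `η = u ∘ a`)

Topic `AlgebraicGeometry/ModuliOfAbelianVarieties`; namespace
`Literature.AlgebraicGeometry.ModuliOfAbelianVarieties.SiegelAdelicMarking`.  Cell hodgecm-mathlib (D-0151), rung-0 U-DAG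
brick **B4 (b)** (B-p03 CENSUS-B4 §2 (b); router B-plan1 R50 (b), director s109): the CONSTRUCTION half of the (U3)
admissibility clause `IsAdmissibleAt` (★ `SiegelModuliComplexUniformisation`).  THEOREMS ONLY (no definition, no named fact,
no instance, no `sorry`); ★ T1′ `SiegelAdelicMarking` / ★ R60-58 `SiegelAdelicCongrTransport` / ★ D3
`LevelStructure.SymplecticLift` currency.  HC_CM is proved only modulo the 7 printed citations until rung 0 closes.

SETTING.  `B` an abelian scheme over `S` with a level-`N` structure `φ`, a point `s : Spec ℂ → S`, the fibre
`A := B(s)` (a complex abelian variety), a divisor `Θ` on it, and a T1′ MARKING `m` of `A` by `[J, a]`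
(`a ∈ GSp_δ(𝔸_f)`: a uniformisation `A(ℂ) ≅ (V_ℝ, J)/Λ_a` with its torsion parametrisation `u = m.r : V → A(ℂ)_tors`,
`ker u = Λ_a`).  A point `P ∈ A(ℂ)` is READ at the class `c ∈ V/ℤ^{2g}` through `a` when `P = u(v)` for every `v` with
`a⁻¹ v̂ ≡ ĉ (mod ẑ^{2g})` (★ `AdelicCongr a⁻¹ 1 v c`; the reading rule of ★ `SiegelAdelicMarkingLevelReading`, of (U)'s
`IsAdmissibleAt` and of the W-layer's `MarkedBy`).

* §0 class arithmetic of the rational lifts `x̃/M := ((x i).val / M)ᵢ` of `x ∈ (ℤ/M)^{2g}` modulo `ℤ^{2g} = Λ_1`: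
  additivity, reduction `ℤ/kM → ℤ/M`, `x̃/M ∈ ℤ^{2g} ⇒ x = 0`, and every `w ∈ M⁻¹ℤ^{2g}` is some `x̃/M` mod `ℤ^{2g}`;
* §1 READINGS through `a`: well-definedness (`u(v) = u(v′)` iff the classes agree mod `ℤ^{2g}`), `M`-torsion of the
  reading of a class in `M⁻¹ℤ^{2g}/ℤ^{2g}`, and conversely every `M`-torsion point of `A(ℂ)` is read at some `x̃/M`
  (★ T1′ `mem_torsionPoints_iff_exists_r_eq` + ★ R60-58 totality) — i.e. «`u ∘ a` identifies `M⁻¹ẑ^{2g}/ẑ^{2g} = (ℤ/M)^{2g}`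
  with `A[M](ℂ)`» ([Milne2005ShimuraVarieties] (63) `η = u ∘ a`);
* §2 **`exists_symplecticLift_of_levelReading`** — GIVEN a compatible system of primitive roots `ζ_M` for which the Weil
  pairing of `Θ` on points READ at `x̃/M`, `ỹ/M` is `ζ_M ^ E_δ(x, y)` (hypothesis `hpair`: the D5 identity «algebraic
  `ē^Θ_M` = analytic `exp(2πi·M·E)`» in Siegel normal form, NOT proved here) and GIVEN that the level sections `σᵢ(s)` are
  read at `eᵢ/N` (hypothesis `hlevel`), there EXISTS a D3 symplectic lift `Λ` of `(φ, Θ)` of type `δ` at `s` with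
  `Λ.ζ = ζ` whose whole tower is read through `a`: `a⁻¹ v̂ ≡ x̃/M ⟹ Λ_M(x) = u(v)` — VERBATIM the tower clause of ★
  `IsAdmissibleAt`.  ([Lan2013PELCompactifications] Lemma 1.3.6.5 «there exists (noncanonically) a symplectic isomorphism
  `α̂ : L ⊗ ẑ ⥲ T A_s̄` lifting `α_n`»: here `α̂` IS `u ∘ a` restricted to `ẑ^{2g}`, and the content proved is that its
  finite layers are bijective compatible group isomorphisms `(ℤ/M)^{2g} ⥲ A[M](ℂ)`; the symplectic clause is the input.)

## References
* [Lan2013PELCompactifications] K.-W. Lan, *Arithmetic compactifications of PEL-type Shimura varieties* (2013), §1.3.6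
  Def. 1.3.6.2 (p. 80), Lemma 1.3.6.5 (p. 81).
* [Deligne1971TravauxShimura] P. Deligne, *Travaux de Shimura*, Sém. Bourbaki 389 (1971), 4.12 (b) p. 149, 4.16 p. 150.
* [Milne2005ShimuraVarieties] J. S. Milne, *Introduction to Shimura varieties* (2005), §6 Thm. 6.11 p. 74 and p. 75,
  §12 (63) p. 116 (`η = u ∘ a`).
-/

set_option autoImplicit false

noncomputable section

open Matrix CategoryTheory AlgebraicGeometry
open Literature.AlgebraicGeometry.Motives (AbelianVariety AlgPoints CartierDivisor)
open Literature.AlgebraicGeometry.AbelianSchemes (AbelianSchemeOver)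
open Literature.NumberTheory.Adeles (latticeOfGL mem_latticeOfGL_one_iff)

namespace Literature.AlgebraicGeometry.ModuliOfAbelianVarieties

namespace SiegelAdelicMarking

variable {g : ℕ} {δ : Fin g → ℕ}

/-! ### §0. Class arithmetic of `x̃/M` modulo `ℤ^{2g}` -/

section Classes

/-- `x̃/M + ỹ/M ≡ (x + y)~/M (mod ℤ^{2g})`. [cite: Milne2005ShimuraVarieties, §6 p. 75] -/
theorem valDiv_add_sub_mem_latticeOfGL_one (M : ℕ) (x y : Fin g ⊕ Fin g → ZMod M) :
    ((fun i => (((x + y) i).val : ℚ) / M) - ((fun i => ((x i).val : ℚ) / M) + fun i => ((y i).val : ℚ) / M)) ∈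
      latticeOfGL (1 : GL (Fin g ⊕ Fin g) finAdeleQ) := by
  refine mem_latticeOfGL_one_iff.2 fun i => ?_
  rcases Nat.eq_zero_or_pos M with rfl | hM
  · exact ⟨0, by simp⟩
  haveI : NeZero M := ⟨hM.ne'⟩
  set d : ℕ := ((x i).val + (y i).val) / M with hd
  refine ⟨-(d : ℤ), ?_⟩
  have hM' : (M : ℚ) ≠ 0 := Nat.cast_ne_zero.2 hM.ne'
  have hval : ((x i + y i).val : ℚ) = (x i).val + (y i).val - M * d := by
    have hmod : ((x i).val + (y i).val) % M + M * d = (x i).val + (y i).val := Nat.mod_add_div _ M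
    rw [ZMod.val_add, eq_sub_iff_add_eq]
    exact_mod_cast hmod
  simp only [Pi.sub_apply, Pi.add_apply]
  rw [hval, Int.cast_neg, Int.cast_natCast]
  field_simp
  ring

/-- Reduction `ℤ/kM → ℤ/M` on classes: `(x mod M)~/M ≡ k • x̃/(kM) (mod ℤ^{2g})`. [cite: Lan2013PELCompactifications, §1.3.6 Lemma 1.3.6.5 (p. 81)] -/
theorem valDiv_castHom_sub_nsmul_mem_latticeOfGL_one {M : ℕ} (k : ℕ) (hM : M ≠ 0) (hk : k ≠ 0)
    (x : Fin g ⊕ Fin g → ZMod (k * M)) :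
    ((fun i => ((ZMod.castHom (Dvd.intro_left k rfl) (ZMod M) (x i)).val : ℚ) / M) -
        k • fun i => ((x i).val : ℚ) / (k * M : ℕ)) ∈ latticeOfGL (1 : GL (Fin g ⊕ Fin g) finAdeleQ) := by
  haveI : NeZero M := ⟨hM⟩
  haveI : NeZero (k * M) := ⟨Nat.mul_ne_zero hk hM⟩
  refine mem_latticeOfGL_one_iff.2 fun i => ?_
  set d : ℕ := (x i).val / M with hd
  refine ⟨-(d : ℤ), ?_⟩
  have hM' : (M : ℚ) ≠ 0 := Nat.cast_ne_zero.2 hM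
  have hk' : (k : ℚ) ≠ 0 := Nat.cast_ne_zero.2 hk
  have hcast : (ZMod.castHom (Dvd.intro_left k rfl) (ZMod M) (x i)).val = (x i).val % M := by
    rw [ZMod.castHom_apply, ZMod.cast_eq_val, ZMod.val_natCast]
  have hq : (((ZMod.castHom (Dvd.intro_left k rfl) (ZMod M) (x i)).val : ℕ) : ℚ) = ((x i).val : ℚ) - M * d := by
    have hmod : (x i).val % M + M * d = (x i).val := Nat.mod_add_div _ M
    rw [hcast, eq_sub_iff_add_eq]; exact_mod_cast hmod
  simp only [Pi.sub_apply, Pi.smul_apply]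
  rw [hq, Int.cast_neg, Int.cast_natCast, nsmul_eq_mul, Nat.cast_mul]
  field_simp
  ring

/-- `x̃/M ∈ ℤ^{2g} ⟹ x = 0` (the coordinates `0 ≤ x̃ᵢ < M`). [cite: Milne2005ShimuraVarieties, §6 p. 75] -/
theorem eq_zero_of_valDiv_mem_latticeOfGL_one {M : ℕ} (hM : M ≠ 0) (x : Fin g ⊕ Fin g → ZMod M)
    (hx : (fun i => ((x i).val : ℚ) / M) ∈ latticeOfGL (1 : GL (Fin g ⊕ Fin g) finAdeleQ)) : x = 0 := by
  haveI : NeZero M := ⟨hM⟩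
  funext i
  obtain ⟨z, hz⟩ := mem_latticeOfGL_one_iff.1 hx i
  have hM' : (M : ℚ) ≠ 0 := Nat.cast_ne_zero.2 hM
  have hzM : (z : ℚ) * M = (x i).val := by rw [hz]; field_simp
  have hzM' : z * M = (x i).val := by exact_mod_cast hzM
  have hlt : (x i).val < M := ZMod.val_lt (x i)
  have hz0 : 0 ≤ z := by
    by_contra h
    have : z * (M : ℤ) < 0 := mul_neg_of_neg_of_pos (lt_of_not_ge h) (by exact_mod_cast Nat.pos_of_ne_zero hM)
    omega
  have hz1 : z < 1 := by
    by_contra h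
    have : (M : ℤ) ≤ z * M := le_mul_of_one_le_left (by positivity) (le_of_not_gt h)
    omega
  have hz00 : z = 0 := by omega
  rw [hz00, zero_mul] at hzM'
  exact (ZMod.val_eq_zero (x i)).1 (by exact_mod_cast hzM'.symm)

/-- Every `w ∈ M⁻¹ℤ^{2g}` is `x̃/M` modulo `ℤ^{2g}` for some `x ∈ (ℤ/M)^{2g}`. [cite: Milne2005ShimuraVarieties, §6 p. 75] -/
theorem exists_valDiv_sub_mem_latticeOfGL_one {M : ℕ} (hM : M ≠ 0) {w : Fin g ⊕ Fin g → ℚ}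
    (hw : M • w ∈ latticeOfGL (1 : GL (Fin g ⊕ Fin g) finAdeleQ)) :
    ∃ x : Fin g ⊕ Fin g → ZMod M,
      ((fun i => ((x i).val : ℚ) / M) - w) ∈ latticeOfGL (1 : GL (Fin g ⊕ Fin g) finAdeleQ) := by
  haveI : NeZero M := ⟨hM⟩
  have hM' : (M : ℚ) ≠ 0 := Nat.cast_ne_zero.2 hM
  choose z hz using mem_latticeOfGL_one_iff.1 hw
  refine ⟨fun i => ((z i : ℤ) : ZMod M), mem_latticeOfGL_one_iff.2 fun i => ⟨-(z i / M), ?_⟩⟩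
  have hzi : w i = (z i : ℚ) / M := by
    have := hz i
    simp only [Pi.smul_apply, nsmul_eq_mul] at this
    rw [eq_div_iff hM', mul_comm]; exact this.symm
  have hval : ((((z i : ℤ) : ZMod M)).val : ℤ) = z i % (M : ℤ) := ZMod.val_intCast (z i)
  have hval' : ((((z i : ℤ) : ZMod M)).val : ℚ) = ((z i % (M : ℤ) : ℤ) : ℚ) := by exact_mod_cast hval
  simp only [Pi.sub_apply, hzi, hval']
  rw [Int.emod_def]
  field_simp
  push_cast
  ring

/-- `M • (x̃/M) ∈ ℤ^{2g}` (★ `nsmul_val_div_mem_latticeOfGL_one`, extended to the junk level `M = 0`).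
[cite: Milne2005ShimuraVarieties, §6 p. 75] -/
theorem nsmul_valDiv_mem_latticeOfGL_one (M : ℕ) (x : Fin g ⊕ Fin g → ZMod M) :
    M • (fun i => ((x i).val : ℚ) / M) ∈ latticeOfGL (1 : GL (Fin g ⊕ Fin g) finAdeleQ) := by
  rcases Nat.eq_zero_or_pos M with rfl | hM
  · rw [zero_smul]; exact zero_mem _
  · exact nsmul_val_div_mem_latticeOfGL_one hM.ne' x

end Classes

/-! ### §1. Readings through `a`: well-definedness, torsion, and exhaustion of `A[M](ℂ)` -/

section Readings

variable {J : C0pm δ} {a : gspFinAdelic δ} {A : AbelianVariety ℂ} (m : SiegelAdelicMarking J a A)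

/-- **Well-definedness of readings**: for `a⁻¹ v̂ ≡ ĉ` and `a⁻¹ v̂′ ≡ ĉ′`, `u(v) = u(v′) ↔ c − c′ ∈ ℤ^{2g}` (★ R60-58
`AdelicCongr.sub_mem_latticeOfGL_iff` + ★ T1′ `r_eq_r_iff_sub_mem_latticeOfGL`). [cite: Milne2005ShimuraVarieties, §6 Thm. 6.11 p. 74 and p. 75] -/
theorem r_eq_r_iff_of_adelicCongr_one {v v' c c' : Fin g ⊕ Fin g → ℚ}
    (hv : AdelicCongr ((a⁻¹ : gspFinAdelic δ) : GL (Fin g ⊕ Fin g) finAdeleQ) 1 v c)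
    (hv' : AdelicCongr ((a⁻¹ : gspFinAdelic δ) : GL (Fin g ⊕ Fin g) finAdeleQ) 1 v' c') :
    m.r v = m.r v' ↔ c - c' ∈ latticeOfGL (1 : GL (Fin g ⊕ Fin g) finAdeleQ) := by
  rw [m.r_eq_r_iff_sub_mem_latticeOfGL, ← latticeOfGL_inv_coe_inv_eq a, hv.sub_mem_latticeOfGL_iff hv', inv_one]

/-- Readings of congruent classes agree: `c − c′ ∈ ℤ^{2g} ⟹ u(v) = u(v′)`. [cite: Milne2005ShimuraVarieties, §6 Thm. 6.11 p. 74 and p. 75] -/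
theorem r_eq_r_of_adelicCongr_one {v v' c c' : Fin g ⊕ Fin g → ℚ}
    (hv : AdelicCongr ((a⁻¹ : gspFinAdelic δ) : GL (Fin g ⊕ Fin g) finAdeleQ) 1 v c)
    (hv' : AdelicCongr ((a⁻¹ : gspFinAdelic δ) : GL (Fin g ⊕ Fin g) finAdeleQ) 1 v' c')
    (h : c - c' ∈ latticeOfGL (1 : GL (Fin g ⊕ Fin g) finAdeleQ)) : m.r v = m.r v' :=
  (m.r_eq_r_iff_of_adelicCongr_one hv hv').2 h

/-- **The reading of a class in `M⁻¹ℤ^{2g}` is `M`-torsion**: `a⁻¹ v̂ ≡ ĉ`, `M c ∈ ℤ^{2g}` ⟹ `u(v) ∈ A[M](ℂ)`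
(`M v ∈ Λ_a` by ★ R60-58 `nsmul_mem_latticeOfGL_iff`, then ★ T1′ `r_pow_eq_one_of_nsmul_mem`).
[cite: Milne2005ShimuraVarieties, §6 Thm. 6.11 p. 74 and §12 (63) p. 116] -/
theorem r_mem_torsionPoints_of_adelicCongr_one {M : ℕ} {v c : Fin g ⊕ Fin g → ℚ}
    (hv : AdelicCongr ((a⁻¹ : gspFinAdelic δ) : GL (Fin g ⊕ Fin g) finAdeleQ) 1 v c)
    (hc : M • c ∈ latticeOfGL (1 : GL (Fin g ⊕ Fin g) finAdeleQ)) : m.r v ∈ A.torsionPoints ℂ (M : ℤ) := by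
  have hMv : M • v ∈ latticeOfGL (a : GL (Fin g ⊕ Fin g) finAdeleQ) := by
    have h := (hv.nsmul_mem_latticeOfGL_iff M).2 (by rwa [inv_one])
    rwa [latticeOfGL_inv_coe_inv_eq] at h
  rw [AbelianVariety.mem_torsionPoints_iff, zpow_natCast]
  exact m.r_pow_eq_one_of_nsmul_mem hMv

/-- **Every `M`-torsion point is read at some `x̃/M`** (`M ≠ 0`): for `T ∈ A[M](ℂ)` there are `x ∈ (ℤ/M)^{2g}` and
`v` with `a⁻¹ v̂ ≡ x̃/M` and `u(v) = T` (★ T1′ `mem_torsionPoints_iff_exists_r_eq`: `T = u(v)`, `M v ∈ Λ_a`; ★ R60-58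
`exists_adelicCongr_right`: a partner `w ∈ M⁻¹ℤ^{2g}` of `v`; §0: `w ≡ x̃/M`). [cite: Milne2005ShimuraVarieties, §6 Thm. 6.11 p. 74 and §12 (63) p. 116] -/
theorem exists_adelicCongr_one_valDiv_r_eq {M : ℕ} (hM : M ≠ 0) {T : A.Points ℂ}
    (hT : T ∈ A.torsionPoints ℂ (M : ℤ)) :
    ∃ (x : Fin g ⊕ Fin g → ZMod M) (v : Fin g ⊕ Fin g → ℚ),
      AdelicCongr ((a⁻¹ : gspFinAdelic δ) : GL (Fin g ⊕ Fin g) finAdeleQ) 1 v (fun i => ((x i).val : ℚ) / M) ∧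
        m.r v = T := by
  obtain ⟨v, hMv, hvT⟩ := (m.mem_torsionPoints_iff_exists_r_eq hM T).1 hT
  obtain ⟨w, hvw⟩ := exists_adelicCongr_right ((a⁻¹ : gspFinAdelic δ) : GL (Fin g ⊕ Fin g) finAdeleQ) 1 v
  have hMw : M • w ∈ latticeOfGL (1 : GL (Fin g ⊕ Fin g) finAdeleQ) := by
    have h := (hvw.nsmul_mem_latticeOfGL_iff M).1 (by rwa [latticeOfGL_inv_coe_inv_eq])
    rwa [inv_one] at h
  obtain ⟨x, hx⟩ := exists_valDiv_sub_mem_latticeOfGL_one hM hMw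
  exact ⟨x, v, hvw.of_sub_mem_latticeOfGL_right (by rwa [inv_one]), hvT⟩

/-- Readings exist: every class `c` has a `v` with `a⁻¹ v̂ ≡ ĉ` (★ R60-58 totality, restated for the reading shape).
[cite: Milne2005ShimuraVarieties, §6 Thm. 6.11 p. 74 and p. 75] -/
theorem exists_adelicCongr_inv_one (c : Fin g ⊕ Fin g → ℚ) :
    ∃ v : Fin g ⊕ Fin g → ℚ, AdelicCongr ((a⁻¹ : gspFinAdelic δ) : GL (Fin g ⊕ Fin g) finAdeleQ) 1 v c :=
  exists_adelicCongr_left _ 1 c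

/-- A point READ at `c` (in the `∀`-form of ★ `SiegelAdelicMarkingLevelReading`) from ONE witness: if `a⁻¹ v̂₀ ≡ ĉ` and
`P = u(v₀)` then `P = u(v)` for every `v` with `a⁻¹ v̂ ≡ ĉ`. [cite: Milne2005ShimuraVarieties, §6 Thm. 6.11 p. 74 and p. 75] -/
theorem forall_eq_r_of_adelicCongr_one {c v₀ : Fin g ⊕ Fin g → ℚ} {P : A.Points ℂ}
    (hv₀ : AdelicCongr ((a⁻¹ : gspFinAdelic δ) : GL (Fin g ⊕ Fin g) finAdeleQ) 1 v₀ c) (hP : P = m.r v₀)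
    (v : Fin g ⊕ Fin g → ℚ) (hv : AdelicCongr ((a⁻¹ : gspFinAdelic δ) : GL (Fin g ⊕ Fin g) finAdeleQ) 1 v c) :
    P = m.r v := by
  rw [hP]
  exact m.r_eq_r_of_adelicCongr_one hv₀ hv (by rw [sub_self]; exact zero_mem _)

end Readings

/-! ### §2. The symplectic lift BUILT from the marking (B4 (b)) -/

section Lift

variable {J : C0pm δ} {a : gspFinAdelic δ}
variable {N : ℕ} {S : Scheme} {B : AbelianSchemeOver S} {s : Spec (.of ℂ) ⟶ S}

/-- **B4 (b): a SYMPLECTIC LIFT of `(φ, Θ)` of type `δ` at `s`, BUILT from a marking of the fibre by `[J, a]` and READ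
through `a`.**  Let `m` mark the fibre `A = B(s)` by `[J, a]` (`u = m.r` its torsion parametrisation), and let
`ζ = (ζ_M)_{N ∣ M}` be a compatible system of primitive roots of unity.  Suppose
(`hpair`) for every level `N ∣ M` the Weil pairing of `Θ` on `M`-torsion points READ at `x̃/M`, `ỹ/M` through `a` is
`ζ_M ^ E_δ(x, y)` — the symplectic clause, an INPUT here (in the cell: the D5 identity «algebraic `ē^Θ_M` = analytic
pairing» in Siegel normal form) — and (`hlevel`) every level section `σᵢ(s)` is read at the class `eᵢ/N`.  THEN there is
a symplectic lift `Λ` ([Lan2013PELCompactifications] Lemma 1.3.6.5: «there exists (noncanonically) a symplectic isomorphism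
`α̂ : L ⊗ ẑ ⥲ T A_s̄` lifting `α_n`»; [Deligne1971TravauxShimura] 4.12 (b)) with `Λ.ζ = ζ` whose WHOLE TOWER is read
through `a`: `a⁻¹ v̂ ≡ x̃/M (mod ẑ^{2g}) ⟹ Λ_M(x) = u(v)` — verbatim the tower clause of ★ `IsAdmissibleAt` ((U3) of ★
`siegelModuli_complexUniformisation`; Milne's `η = u ∘ a`).  Construction: `Λ_M(x) := u(v)` for any `a`-partner `v` of
`x̃/M` (§1 well-definedness); a group homomorphism (`u` additive, ★ R60-58 additivity), `M`-torsion-valued and ONTO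
`A[M](ℂ)` (§1), injective (`u(v) = 1 ⟹ v ∈ Λ_a ⟹ x̃/M ∈ ℤ^{2g} ⟹ x = 0`), compatible in the tower (`u(k•v) = u(v)^k`).
[cite: Lan2013PELCompactifications, §1.3.6 Def. 1.3.6.2 (p. 80) and Lemma 1.3.6.5 (p. 81)]
[cite: Deligne1971TravauxShimura, 4.12 (b) p. 149 and 4.16 p. 150] [cite: Milne2005ShimuraVarieties, §6 Thm. 6.11 p. 74 and §12 (63) p. 116] -/
theorem exists_symplecticLift_of_levelReading (φ : B.LevelStructure g N)
    (Θ : CartierDivisor (B.fibre s).toAbelianVariety.X.left)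
    (m : SiegelAdelicMarking J a (B.fibre s).toAbelianVariety)
    (ζ : ℕ → ℂ) (hζ : ∀ ⦃M : ℕ⦄, N ∣ M → M ≠ 0 → IsPrimitiveRoot (ζ M) M)
    (hζ_pow : ∀ ⦃M : ℕ⦄ (k : ℕ), N ∣ M → M ≠ 0 → k ≠ 0 → ζ (k * M) ^ k = ζ M)
    (hpair : ∀ ⦃M : ℕ⦄, N ∣ M → ∀ (hMΩ : (M : ℂ) ≠ 0) (x y : Fin g ⊕ Fin g → ZMod M)
      (P Q : (B.fibre s).toAbelianVariety.torsionPoints ℂ (M : ℤ)),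
      (∀ v, AdelicCongr ((a⁻¹ : gspFinAdelic δ) : GL (Fin g ⊕ Fin g) finAdeleQ) 1 v
          (fun i => ((x i).val : ℚ) / M) → (P : (B.fibre s).toAbelianVariety.Points ℂ) = m.r v) →
      (∀ w, AdelicCongr ((a⁻¹ : gspFinAdelic δ) : GL (Fin g ⊕ Fin g) finAdeleQ) 1 w
          (fun i => ((y i).val : ℚ) / M) → (Q : (B.fibre s).toAbelianVariety.Points ℂ) = m.r w) →
      haveI := AbelianVariety.isDominant_toSchemeHom_zsmul_of_ne_zero (B.fibre s).toAbelianVariety hMΩ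
      (B.fibre s).toAbelianVariety.weilPairingLevel Θ P Q = ζ M ^ (AbelianSchemeOver.typeFormMod δ M x y).val)
    (hlevel : ∀ i : Fin g ⊕ Fin g, ∃ v : Fin g ⊕ Fin g → ℚ,
      AdelicCongr ((a⁻¹ : gspFinAdelic δ) : GL (Fin g ⊕ Fin g) finAdeleQ) 1 v
          (fun j => (((Pi.single i (1 : ZMod N) : Fin g ⊕ Fin g → ZMod N) j).val : ℚ) / N) ∧
        B.restrictPt s (φ.σ i) = m.r v) :
    ∃ Λ : φ.SymplecticLift s Θ δ, (∀ M, Λ.ζ M = ζ M) ∧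
      ∀ ⦃M : ℕ⦄, N ∣ M → M ≠ 0 → ∀ (x : Fin g ⊕ Fin g → ZMod M) (v : Fin g ⊕ Fin g → ℚ),
        AdelicCongr ((a⁻¹ : gspFinAdelic δ) : GL (Fin g ⊕ Fin g) finAdeleQ) 1 v (fun i => ((x i).val : ℚ) / M) →
          ((Λ.lift M (Multiplicative.ofAdd x)) : (B.fibre s).toAbelianVariety.Points ℂ) = m.r v := by
  classical
  -- a chosen `a`-partner `vOf M x` of every class `x̃/M`
  have hex : ∀ (M : ℕ) (x : Fin g ⊕ Fin g → ZMod M), ∃ v : Fin g ⊕ Fin g → ℚ,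
      AdelicCongr ((a⁻¹ : gspFinAdelic δ) : GL (Fin g ⊕ Fin g) finAdeleQ) 1 v (fun i => ((x i).val : ℚ) / M) :=
    fun M x => exists_adelicCongr_inv_one _
  choose vOf hvOf using hex
  -- the readings are `M`-torsion
  have htor : ∀ (M : ℕ) (x : Fin g ⊕ Fin g → ZMod M),
      m.r (vOf M x) ∈ (B.fibre s).toAbelianVariety.torsionPoints ℂ (M : ℤ) :=
    fun M x => m.r_mem_torsionPoints_of_adelicCongr_one (hvOf M x) (nsmul_valDiv_mem_latticeOfGL_one M x)
  -- the level-`M` layer as a function, and its multiplicativity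
  let f : (M : ℕ) → Multiplicative (Fin g ⊕ Fin g → ZMod M) →
      (B.fibre s).toAbelianVariety.torsionPoints ℂ (M : ℤ) :=
    fun M x => ⟨m.r (vOf M (Multiplicative.toAdd x)), htor M _⟩
  have hmul : ∀ (M : ℕ) (x y : Multiplicative (Fin g ⊕ Fin g → ZMod M)), f M (x * y) = f M x * f M y := by
    intro M x y
    apply Subtype.ext
    change m.r (vOf M (Multiplicative.toAdd (x * y))) =
      m.r (vOf M (Multiplicative.toAdd x)) * m.r (vOf M (Multiplicative.toAdd y))
    rw [toAdd_mul, ← m.r_add]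
    exact m.r_eq_r_of_adelicCongr_one (hvOf M _) ((hvOf M _).add (hvOf M _))
      (valDiv_add_sub_mem_latticeOfGL_one M _ _)
  let L : (M : ℕ) → Multiplicative (Fin g ⊕ Fin g → ZMod M) →*
      (B.fibre s).toAbelianVariety.torsionPoints ℂ (M : ℤ) :=
    fun M => MonoidHom.mk' (f M) (hmul M)
  have hL : ∀ (M : ℕ) (x : Fin g ⊕ Fin g → ZMod M),
      ((L M (Multiplicative.ofAdd x) : (B.fibre s).toAbelianVariety.torsionPoints ℂ (M : ℤ)) :
        (B.fibre s).toAbelianVariety.Points ℂ) = m.r (vOf M x) := fun M x => rfl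
  -- THE TOWER CLAUSE: every layer is read through `a`
  have htower : ∀ (M : ℕ) (x : Fin g ⊕ Fin g → ZMod M) (v : Fin g ⊕ Fin g → ℚ),
      AdelicCongr ((a⁻¹ : gspFinAdelic δ) : GL (Fin g ⊕ Fin g) finAdeleQ) 1 v (fun i => ((x i).val : ℚ) / M) →
        ((L M (Multiplicative.ofAdd x) : (B.fibre s).toAbelianVariety.torsionPoints ℂ (M : ℤ)) :
          (B.fibre s).toAbelianVariety.Points ℂ) = m.r v := by
    intro M x v hv
    rw [hL]
    exact m.r_eq_r_of_adelicCongr_one (hvOf M x) hv (by rw [sub_self]; exact zero_mem _)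
  -- bijectivity of every layer `M ≠ 0` (no divisibility needed)
  have hbij : ∀ ⦃M : ℕ⦄, N ∣ M → M ≠ 0 → Function.Bijective (L M) := by
    intro M _ hM0
    refine ⟨(injective_iff_map_eq_one (L M)).2 fun x hx => ?_, fun T => ?_⟩
    · have h1 : m.r (vOf M (Multiplicative.toAdd x)) = 1 := by
        have h := congrArg Subtype.val hx
        rwa [← ofAdd_toAdd x, hL] at h
      have h2 : vOf M (Multiplicative.toAdd x) ∈ latticeOfGL (a : GL (Fin g ⊕ Fin g) finAdeleQ) :=
        (m.r_eq_one_iff_mem_latticeOfGL _).1 h1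
      have h3 : (fun i => (((Multiplicative.toAdd x) i).val : ℚ) / M) ∈
          latticeOfGL (1 : GL (Fin g ⊕ Fin g) finAdeleQ) := by
        have h := (hvOf M (Multiplicative.toAdd x)).mem_latticeOfGL_iff.1 (by rwa [latticeOfGL_inv_coe_inv_eq])
        rwa [inv_one] at h
      rw [← ofAdd_toAdd x, eq_zero_of_valDiv_mem_latticeOfGL_one hM0 _ h3, ofAdd_zero]
    · obtain ⟨x, v, hv, hvT⟩ := m.exists_adelicCongr_one_valDiv_r_eq hM0 T.2
      exact ⟨Multiplicative.ofAdd x, Subtype.ext ((htower M x v hv).trans hvT)⟩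
  -- compatibility in the tower: `Λ_M(x mod M) = Λ_{kM}(x)^k`
  have hcompat : ∀ ⦃M : ℕ⦄ (k : ℕ) (x : Fin g ⊕ Fin g → ZMod (k * M)), N ∣ M → M ≠ 0 → k ≠ 0 →
      ((L M (Multiplicative.ofAdd fun i => ZMod.castHom (Dvd.intro_left k rfl) (ZMod M) (x i)) :
          (B.fibre s).toAbelianVariety.torsionPoints ℂ (M : ℤ)) : (B.fibre s).toAbelianVariety.Points ℂ) =
        (((L (k * M) (Multiplicative.ofAdd x)) : (B.fibre s).toAbelianVariety.torsionPoints ℂ ((k * M : ℕ) : ℤ)) :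
          (B.fibre s).toAbelianVariety.Points ℂ) ^ k := by
    intro M k x _ hM0 hk0
    rw [hL, hL, ← m.r_nsmul]
    exact m.r_eq_r_of_adelicCongr_one (hvOf M _) ((hvOf (k * M) x).nsmul k)
      (valDiv_castHom_sub_nsmul_mem_latticeOfGL_one k hM0 hk0 x)
  -- the level-`N` layer IS `φ(s)`
  have hlev : ∀ i : Fin g ⊕ Fin g,
      ((L N (Multiplicative.ofAdd (Pi.single i 1)) : (B.fibre s).toAbelianVariety.torsionPoints ℂ (N : ℤ)) :
        (B.fibre s).toAbelianVariety.Points ℂ) = B.restrictPt s (φ.σ i) := by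
    intro i
    obtain ⟨v, hv, hσ⟩ := hlevel i
    rw [hσ]
    exact htower N (Pi.single i 1) v hv
  -- the symplectic clause, from `hpair` at the readings
  have hpr : ∀ ⦃M : ℕ⦄, N ∣ M → ∀ (hMΩ : (M : ℂ) ≠ 0) (x y : Fin g ⊕ Fin g → ZMod M),
      haveI := AbelianVariety.isDominant_toSchemeHom_zsmul_of_ne_zero (B.fibre s).toAbelianVariety hMΩ
      (B.fibre s).toAbelianVariety.weilPairingLevel Θ (L M (Multiplicative.ofAdd x))
        (L M (Multiplicative.ofAdd y)) = ζ M ^ (AbelianSchemeOver.typeFormMod δ M x y).val :=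
    fun M hNM hMΩ x y => hpair hNM hMΩ x y _ _ (fun v hv => htower M x v hv) (fun w hw => htower M y w hw)
  let Λ : φ.SymplecticLift s Θ δ :=
    { ζ := ζ
      isPrimitiveRoot_ζ := hζ
      ζ_pow := hζ_pow
      lift := L
      lift_bijective := hbij
      lift_compat := hcompat
      lift_level := hlev
      pairing := hpr }
  exact ⟨Λ, fun _ => rfl, fun M _ _ x v hv => htower M x v hv⟩

/-- **B4 (b), `∀`-reading form of `hlevel`** (the shape of ★ `SiegelAdelicMarkingLevelReading` / `restrictPt_level_eq_r_of_lift`: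
`σᵢ(s) = u(v)` for EVERY `a`-partner `v` of `eᵢ/N`) — same conclusion. [cite: Lan2013PELCompactifications, §1.3.6 Lemma 1.3.6.5 (p. 81)]
[cite: Milne2005ShimuraVarieties, §6 Thm. 6.11 p. 74 and p. 75] -/
theorem exists_symplecticLift_of_forall_levelReading (φ : B.LevelStructure g N)
    (Θ : CartierDivisor (B.fibre s).toAbelianVariety.X.left)
    (m : SiegelAdelicMarking J a (B.fibre s).toAbelianVariety)
    (ζ : ℕ → ℂ) (hζ : ∀ ⦃M : ℕ⦄, N ∣ M → M ≠ 0 → IsPrimitiveRoot (ζ M) M)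
    (hζ_pow : ∀ ⦃M : ℕ⦄ (k : ℕ), N ∣ M → M ≠ 0 → k ≠ 0 → ζ (k * M) ^ k = ζ M)
    (hpair : ∀ ⦃M : ℕ⦄, N ∣ M → ∀ (hMΩ : (M : ℂ) ≠ 0) (x y : Fin g ⊕ Fin g → ZMod M)
      (P Q : (B.fibre s).toAbelianVariety.torsionPoints ℂ (M : ℤ)),
      (∀ v, AdelicCongr ((a⁻¹ : gspFinAdelic δ) : GL (Fin g ⊕ Fin g) finAdeleQ) 1 v
          (fun i => ((x i).val : ℚ) / M) → (P : (B.fibre s).toAbelianVariety.Points ℂ) = m.r v) →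
      (∀ w, AdelicCongr ((a⁻¹ : gspFinAdelic δ) : GL (Fin g ⊕ Fin g) finAdeleQ) 1 w
          (fun i => ((y i).val : ℚ) / M) → (Q : (B.fibre s).toAbelianVariety.Points ℂ) = m.r w) →
      haveI := AbelianVariety.isDominant_toSchemeHom_zsmul_of_ne_zero (B.fibre s).toAbelianVariety hMΩ
      (B.fibre s).toAbelianVariety.weilPairingLevel Θ P Q = ζ M ^ (AbelianSchemeOver.typeFormMod δ M x y).val)
    (hlevel : ∀ (i : Fin g ⊕ Fin g) (v : Fin g ⊕ Fin g → ℚ),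
      AdelicCongr ((a⁻¹ : gspFinAdelic δ) : GL (Fin g ⊕ Fin g) finAdeleQ) 1 v
          (fun j => (((Pi.single i (1 : ZMod N) : Fin g ⊕ Fin g → ZMod N) j).val : ℚ) / N) →
        B.restrictPt s (φ.σ i) = m.r v) :
    ∃ Λ : φ.SymplecticLift s Θ δ, (∀ M, Λ.ζ M = ζ M) ∧
      ∀ ⦃M : ℕ⦄, N ∣ M → M ≠ 0 → ∀ (x : Fin g ⊕ Fin g → ZMod M) (v : Fin g ⊕ Fin g → ℚ),
        AdelicCongr ((a⁻¹ : gspFinAdelic δ) : GL (Fin g ⊕ Fin g) finAdeleQ) 1 v (fun i => ((x i).val : ℚ) / M) →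
          ((Λ.lift M (Multiplicative.ofAdd x)) : (B.fibre s).toAbelianVariety.Points ℂ) = m.r v :=
  m.exists_symplecticLift_of_levelReading φ Θ ζ hζ hζ_pow hpair fun i =>
    (exists_adelicCongr_inv_one (a := a) _).imp fun v hv => ⟨hv, hlevel i v hv⟩

end Lift

end SiegelAdelicMarking

end Literature.AlgebraicGeometry.ModuliOfAbelianVarieties

end
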